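import Mathlib
import Literature.MathematicalPhysics.QuantumFieldTheory.PottsGaugeEdwardsSokal
import HarnessLib

/-!
# Wilson loop expectations are null-homology probabilities: Duncan–Schweinhart's Theorem 5 on the
# finite torus (PROVED)

Third file of the transcription of the Fortuin–Kasteleyn-type representation of `q`-state Potts
lattice gauge theory (companions: `PlaquetteRandomCluster` — setting, readings, SCOPE caveat:
`ℤ_q`/Potts gauge theory only, nothing here bears on the Yang–Mills mass gap or on
`BalabanLadder.IR`, and in the `ym` ladder only the conditional finite-`𝕋⁴` rung `BalabanLadder.UV`
is closed by any route — and `PottsGaugeEdwardsSokal`).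

Source: P. Duncan, B. Schweinhart, *Topological phases in the plaquette random-cluster model and
Potts lattice gauge theory*, Comm. Math. Phys. **406** (2025), arXiv:2207.08339
[DuncanSchweinhart2025], **Theorem 5**: for a prime `q`, `0 < i < d - 1` and an `(i-1)`-cycle `γ`,
`𝔼_{ν}(W_γ) = μ(V_γ)` with `ν` the `q`-state Potts lattice gauge theory at inverse temperature `β`
and `μ` the plaquette random-cluster model with `p = 1 - e^{-β}` and coefficients `𝔽_q`;
"While we state this theorem for `ℤ^d`, the same proof works for any finite cubical complex."
We prove the finite-complex statement for the torus `𝕋^d_L` and `i = 2` (genuine lattice gauge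
theory), following the printed proof (§5): condition on the plaquettes through the generalised
Edwards–Sokal coupling (Prop. 20/21: given `ω` the cochain is uniform on `Z¹(P(ω); 𝔽_q)`), sum the
character `f ↦ (f(γ))^ℂ` over the `𝔽_q`-vector space `Z¹(P(ω))` — it gives `|Z¹|` if `γ`
annihilates `Z¹(P(ω))` and `0` otherwise (`sum_char_pairing_eq`) — and identify
"`γ ⟂ Z¹(P(ω))`" with "`γ ∈ B₁(P(ω); 𝔽_q)`" by finite-dimensional duality
(`forall_pairing_eq_zero_iff_isNullHomologousIn`; this is where `q` prime = field coefficients is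
used, cf. §1.2 of the source).

## Main statements (all PROVED; no named fact)

* `sum_char_pairing_eq` — orthogonality of characters on the cocycle space;
* `forall_pairing_eq_zero_iff_isNullHomologousIn` — `(∀ θ ∈ Z¹(P(ω); 𝔽_q), θ(γ) = 0) ↔ V_γ(ω)`;
* `pottsExpect_wilsonLoopVar_eq_eventProb` — **Theorem 5** on `𝕋^d_L`:
  `𝔼_{ν_β}(W_γ) = μ_{1-e^{-β}, q}(V_γ)` for every `1`-chain `γ` (the source states it for cycles,
  the only case in which `W_γ` is gauge invariant; the identity itself needs no hypothesis on `γ`).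
-/

open Finset

namespace Literature.MathematicalPhysics.QuantumFieldTheory

namespace PlaquetteRC

open LatticeForm

variable {d L : ℕ} [NeZero L] (q : ℕ) [Fact q.Prime]

/-! ### Character sums over the cocycle space -/

section CharacterSum

/-- `f ↦ f(γ)` is additive. [cite: DuncanSchweinhart2025, §5 (proof of Thm. 5)] -/
theorem pairing_add_left {R : Type*} [CommRing R] (θ θ' γ : Site d L → Fin d → R) :
    pairing (θ + θ') γ = pairing θ γ + pairing θ' γ := by
  unfold pairing
  simp only [Pi.add_apply, add_mul, Finset.sum_add_distrib]

/-- **Orthogonality of characters on `Z¹(P(ω); 𝔽_q)`** (the computation behind `𝔼(W_γ ∣ P) =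
𝟙_{V_γ}` in the proof of Theorem 5): summing the `q`-th root of unity `(f(γ))^ℂ` over the cocycles
`f` of `P(ω)` gives `|Z¹(P(ω))|` if every cocycle annihilates `γ`, and `0` otherwise (shift the
sum by a cocycle `f₀` with `f₀(γ) ≠ 0`). Valid for every `q ≥ 1`. [cite: DuncanSchweinhart2025, §5 (proof of Thm. 5)] -/
theorem sum_char_pairing_eq {n : ℕ} [NeZero n] (ω : Finset (Plaquette d L))
    (γ : Site d L → Fin d → ZMod n) :
    (∑ θ : Site d L → Fin d → ZMod n,
        (if (∀ σ ∈ ω, res (td₁ θ) σ = 0) then (ZMod.stdAddChar (pairing θ γ) : ℂ) else 0)) =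
      if (∀ θ : Site d L → Fin d → ZMod n, (∀ σ ∈ ω, res (td₁ θ) σ = 0) → pairing θ γ = 0) then
        ((Finset.univ.filter fun θ : Site d L → Fin d → ZMod n =>
          ∀ σ ∈ ω, res (td₁ θ) σ = 0).card : ℂ)
      else 0 := by
  classical
  set Z := flatCochains (d := d) (L := L) (ZMod n) (ZMod n) ω with hZ
  have hmemZ : ∀ θ : Site d L → Fin d → ZMod n, θ ∈ Z ↔ ∀ σ ∈ ω, res (td₁ θ) σ = 0 :=
    fun θ => mem_flatCochains
  split_ifs with hall
  · -- every term with `θ ∈ Z` equals `ψ(0) = 1`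
    rw [Finset.card_filter]
    push_cast
    refine Finset.sum_congr rfl fun θ _ => ?_
    by_cases hθ : ∀ σ ∈ ω, res (td₁ θ) σ = 0
    · rw [if_pos hθ, if_pos hθ, hall θ hθ, AddChar.map_zero_eq_one]
    · rw [if_neg hθ, if_neg hθ]
  · push Not at hall
    obtain ⟨θ₀, hθ₀, hne⟩ := hall
    have hθ₀Z : θ₀ ∈ Z := (hmemZ θ₀).mpr hθ₀
    set S := ∑ θ : Site d L → Fin d → ZMod n,
      (if (∀ σ ∈ ω, res (td₁ θ) σ = 0) then (ZMod.stdAddChar (pairing θ γ) : ℂ) else 0) with hS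
    -- shifting the summation variable by `θ₀ ∈ Z` multiplies `S` by `ψ(θ₀(γ)) ≠ 1`
    have hshift : S = ZMod.stdAddChar (pairing θ₀ γ) * S := by
      rw [hS, Finset.mul_sum]
      rw [← Equiv.sum_comp (Equiv.addRight θ₀)]
      refine Finset.sum_congr rfl fun θ _ => ?_
      simp only [Equiv.coe_addRight]
      have hmem : (θ + θ₀ ∈ Z) ↔ θ ∈ Z :=
        ⟨fun h => by simpa using Z.sub_mem h hθ₀Z, fun h => Z.add_mem h hθ₀Z⟩
      by_cases hθ : ∀ σ ∈ ω, res (td₁ θ) σ = 0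
      · have h' : ∀ σ ∈ ω, res (td₁ (θ + θ₀)) σ = 0 :=
          (hmemZ _).mp (hmem.mpr ((hmemZ θ).mpr hθ))
        rw [if_pos h', if_pos hθ, pairing_add_left, AddChar.map_add_eq_mul, mul_comm]
      · have h' : ¬ ∀ σ ∈ ω, res (td₁ (θ + θ₀)) σ = 0 :=
          fun h => hθ ((hmemZ θ).mp (hmem.mp ((hmemZ _).mpr h)))
        rw [if_neg h', if_neg hθ, mul_zero]
    have hψ : (ZMod.stdAddChar (pairing θ₀ γ) : ℂ) ≠ 1 := by
      intro h
      apply hne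
      have h0 : (ZMod.stdAddChar (pairing θ₀ γ) : ℂ) = ZMod.stdAddChar (0 : ZMod n) := by
        rw [h, AddChar.map_zero_eq_one]
      exact ZMod.injective_stdAddChar h0
    have : (1 - ZMod.stdAddChar (pairing θ₀ γ)) * S = 0 := by
      rw [sub_mul, one_mul, ← hshift, sub_self]
    rcases mul_eq_zero.mp this with h | h
    · exact absurd (sub_eq_zero.mp h).symm hψ
    · exact h

end CharacterSum

/-! ### Duality: `Z¹(P(ω))^⊥ = B₁(P(ω))` over the field `𝔽_q` -/

section PlaqInd

variable {R : Type*} [CommRing R]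

/-- The indicator `2`-chain `𝟙_σ` of a plaquette (cell basis of `C₂`). [cite: DuncanSchweinhart2025, §2.1] -/
def plaqInd [DecidableEq (Plaquette d L)] (σ : Plaquette d L) : Plaquette d L → R :=
  fun τ => if τ = σ then 1 else 0

/-- `(δθ)(σ) = ⟨θ, ∂𝟙_σ⟩`. [cite: DuncanSchweinhart2025, §1.1 Def. 2 (δf(σ) = f(∂σ))] -/
theorem res_td₁_eq_pairing_bd₂ [DecidableEq (Plaquette d L)] (θ : Site d L → Fin d → R)
    (σ : Plaquette d L) : res (td₁ θ) σ = pairing θ (bd₂ (plaqInd (R := R) σ)) := by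
  rw [pairing_bd₂]
  unfold pairing₂ plaqInd
  simp

end PlaqInd

section Duality

variable {F : Type*} [Field F]

/-- `f ↦ f(γ)` as a linear functional, and every linear functional on `C¹` is of this form:
`ℓ(γ) = ⟨θ_ℓ, γ⟩` with `θ_ℓ(e) = ℓ(𝟙_e)`. [cite: DuncanSchweinhart2025, §2.4 (cochains as the dual of chains)] -/
theorem dual_apply_eq_pairing (ℓ : Module.Dual F (Site d L → Fin d → F)) (γ : Site d L → Fin d → F) :
    ℓ γ = pairing (fun x k => ℓ (edgeInd (R := F) x k)) γ := by
  conv_lhs => rw [← sum_smul_edgeInd γ]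
  simp only [map_sum, map_smul, smul_eq_mul, pairing]
  refine Finset.sum_congr rfl fun x _ => Finset.sum_congr rfl fun k _ => ?_
  ring

/-- The boundaries `B₁(P(ω); F) = {∂c : c supported on ω}` form a submodule of `C₁`.
[cite: DuncanSchweinhart2025, §2.1 (B_i)] -/
def boundaries (ω : Finset (Plaquette d L)) : Submodule F (Site d L → Fin d → F) where
  carrier := {γ | IsNullHomologousIn ω γ}
  add_mem' := by
    rintro a b ⟨c, hc, rfl⟩ ⟨c', hc', rfl⟩
    refine ⟨c + c', fun σ hσ => by rw [Pi.add_apply, hc σ hσ, hc' σ hσ, add_zero], ?_⟩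
    funext x k
    simp only [bd₂, Pi.add_apply, add_mul, Finset.sum_add_distrib]
  zero_mem' := by
    refine ⟨0, fun _ _ => rfl, ?_⟩
    funext x k
    simp only [bd₂, Pi.zero_apply, zero_mul, Finset.sum_const_zero]
  smul_mem' := by
    rintro r a ⟨c, hc, rfl⟩
    refine ⟨r • c, fun σ hσ => by rw [Pi.smul_apply, hc σ hσ, smul_zero], ?_⟩
    funext x k
    simp only [bd₂, Pi.smul_apply, smul_eq_mul, mul_assoc, Finset.mul_sum]

/-- **`Z¹(P(ω); F)^⊥ = B₁(P(ω); F)` for field coefficients**: a `1`-chain annihilated by every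
cocycle of `P(ω)` is a boundary in `P(ω)` (and conversely). The converse is
`pairing_eq_zero_of_isNullHomologousIn`; the direct implication separates `γ ∉ B₁` from `B₁` by a
linear functional (`Submodule.exists_dual_map_eq_bot_of_notMem`), represented by a cochain `θ`, which
is flat on `ω` because `(δθ)(σ) = ⟨θ, ∂𝟙_σ⟩` and `∂𝟙_σ ∈ B₁` for `σ ∈ ω`. This is the step where
field coefficients (`q` prime) are used (§1.2 of the source). [cite: DuncanSchweinhart2025, §5 (proof of Thm. 5) and §1.2] -/
theorem forall_pairing_eq_zero_iff_isNullHomologousIn (ω : Finset (Plaquette d L))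
    (γ : Site d L → Fin d → F) :
    (∀ θ : Site d L → Fin d → F, (∀ σ ∈ ω, res (td₁ θ) σ = 0) → pairing θ γ = 0) ↔
      IsNullHomologousIn ω γ := by
  classical
  refine ⟨fun h => ?_, fun hγ θ hθ => pairing_eq_zero_of_isNullHomologousIn (R := F) hθ hγ⟩
  by_contra hγ
  have hγ' : γ ∉ boundaries (F := F) ω := hγ
  obtain ⟨ℓ, hℓγ, hℓB⟩ := Submodule.exists_dual_map_eq_bot_of_notMem hγ' inferInstance
  have hℓ : ∀ c, ℓ c = pairing (fun x k => ℓ (edgeInd (R := F) x k)) c := dual_apply_eq_pairing ℓ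
  have hB0 := (Submodule.eq_bot_iff _).mp hℓB
  -- the representing cochain of `ℓ` is a cocycle of `P(ω)`
  have hθZ : ∀ σ ∈ ω, res (td₁ (fun x k => ℓ (edgeInd (R := F) x k))) σ = 0 := by
    intro σ hσ
    rw [res_td₁_eq_pairing_bd₂, ← hℓ]
    have hmem : bd₂ (plaqInd (R := F) σ) ∈ boundaries (F := F) ω :=
      ⟨plaqInd σ, fun τ hτ => by simp [plaqInd, show τ ≠ σ from fun h => hτ (h ▸ hσ)], rfl⟩
    exact hB0 _ (Submodule.mem_map_of_mem hmem)
  exact hℓγ ((hℓ γ).trans (h _ hθZ))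

end Duality

/-! ### Theorem 5 on the finite torus -/

section WilsonLoop

/-- `|H¹(P(ω); 𝔽_q)| = q^{b₁(P(ω); 𝔽_q)}`. [cite: DuncanSchweinhart2025, §5 (proof of Prop. 20: q^{dim})] -/
theorem cohomologyCard_zmod_eq (ω : Finset (Plaquette d L)) :
    cohomologyCard (d := d) (L := L) (ZMod q) (ZMod q) ω = q ^ bettiOne (ZMod q) ω := by
  unfold cohomologyCard bettiOne
  rw [Module.natCard_eq_pow_finrank (K := ZMod q), Nat.card_zmod]

/-- The number of cocycles of `P(ω)` is `|B¹| · q^{b₁(P(ω))}`. [cite: DuncanSchweinhart2025, §5 (proof of Prop. 20)] -/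
theorem card_filter_flat_eq (ω : Finset (Plaquette d L)) :
    ((Finset.univ.filter fun θ : Site d L → Fin d → ZMod q => ∀ σ ∈ ω, res (td₁ θ) σ = 0).card : ℝ) =
      (Nat.card (gradCochains (d := d) (L := L) (ZMod q) (ZMod q)) : ℝ) *
        (q : ℝ) ^ bettiOne (ZMod q) ω := by
  rw [card_filter_flat_eq_natCard (ZMod q) (ZMod q), natCard_flatCochains_eq (ZMod q) (ZMod q),
    cohomologyCard_zmod_eq]
  push_cast
  ring

/-- The Potts partition function through the coupling:
`e^{-β|X²|} 𝒵_β = |B¹| · Z_{RC}(p = 1 - e^{-β}, q)`. [cite: DuncanSchweinhart2025, Prop. 20 (both marginals)] -/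
theorem pottsPartitionFn_eq (β : ℝ) :
    Real.exp (-β * Fintype.card (Plaquette d L)) * pottsPartitionFn (d := d) (L := L) (ZMod q) β =
      (Nat.card (gradCochains (d := d) (L := L) (ZMod q) (ZMod q)) : ℝ) *
        partitionFn (d := d) (L := L) (ZMod q) (esParam β) q := by
  classical
  unfold pottsPartitionFn partitionFn
  rw [Finset.mul_sum]
  simp_rw [← sum_esWeight_eq_pottsWeight]
  rw [Finset.sum_comm, Finset.mul_sum]
  refine Finset.sum_congr rfl fun ω _ => ?_
  rw [sum_esWeight_eq_card, card_filter_flat_eq, weight]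
  ring

/-- **Theorem 5 (Duncan–Schweinhart) on the finite torus `𝕋^d_L`, PROVED.** For a prime `q`, every
real `β` and every `1`-chain `γ` with `𝔽_q`-coefficients, the `q`-state Potts lattice gauge theory
expectation of the Wilson loop variable equals the plaquette random-cluster probability (parameters
`p = 1 - e^{-β}`, `q`, coefficients `𝔽_q`) that `γ` is null-homologous in the plaquette complex:
`𝔼_{ν_{𝕋,β,q}}(W_γ) = μ_{𝕋,1-e^{-β},q}(V_γ)`. (Printed for `(i-1)`-cycles `γ` in `ℤ^d`, `β ≥ 0`,
with the remark that "the same proof works for any finite cubical complex"; `W_γ` is gauge invariant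
only for cycles, but the identity holds for every chain and every `β`.) [cite: DuncanSchweinhart2025, Thm. 5] -/
theorem pottsExpect_wilsonLoopVar_eq_eventProb (β : ℝ) (γ : Site d L → Fin d → ZMod q) :
    pottsExpect (d := d) (L := L) (ZMod q) β (wilsonLoopVar q γ) =
      (eventProb (d := d) (L := L) (ZMod q) (esParam β) q {ω | IsNullHomologousIn ω γ} : ℂ) := by
  classical
  -- abbreviations: `NB = |B¹|`, `E = e^{-β|X²|}`
  set NB : ℝ := (Nat.card (gradCochains (d := d) (L := L) (ZMod q) (ZMod q)) : ℝ) with hNB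
  set E : ℝ := Real.exp (-β * Fintype.card (Plaquette d L)) with hE
  have hEpos : 0 < E := Real.exp_pos _
  have hNBpos : 0 < NB := by
    rw [hNB]
    exact_mod_cast Nat.card_pos (α := gradCochains (d := d) (L := L) (ZMod q) (ZMod q))
  have hZpos := pottsPartitionFn_pos (d := d) (L := L) (ZMod q) β
  -- Step 1: numerator `E Σ_f e^{-βH(f)} W_γ(f) = NB Σ_ω weight(ω) 𝟙_{V_γ}(ω)`
  have hnum : (E : ℂ) * ∑ θ : Site d L → Fin d → ZMod q,
      (pottsWeight (ZMod q) β θ : ℂ) * wilsonLoopVar q γ θ =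
      (NB : ℂ) * ∑ ω : Finset (Plaquette d L),
        if IsNullHomologousIn ω γ then (weight (ZMod q) (esParam β) q ω : ℂ) else 0 := by
    rw [Finset.mul_sum]
    have h1 : ∀ θ : Site d L → Fin d → ZMod q, (E : ℂ) * ((pottsWeight (ZMod q) β θ : ℂ) *
        wilsonLoopVar q γ θ) = ∑ ω : Finset (Plaquette d L),
          (esWeight (ZMod q) β θ ω : ℂ) * wilsonLoopVar q γ θ := by
      intro θ
      rw [← Finset.sum_mul, ← mul_assoc]
      congr 1
      rw [hE]
      exact_mod_cast (sum_esWeight_eq_pottsWeight (ZMod q) β θ).symm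
    simp_rw [h1]
    rw [Finset.sum_comm, Finset.mul_sum]
    refine Finset.sum_congr rfl fun ω _ => ?_
    -- for fixed `ω`: `Σ_θ κ(θ,ω) W_γ(θ) = p^|ω| (1-p)^|ωᶜ| Σ_{θ ∈ Z¹(ω)} ψ(θ(γ))`
    have h2 : ∀ θ : Site d L → Fin d → ZMod q, (esWeight (ZMod q) β θ ω : ℂ) * wilsonLoopVar q γ θ =
        ((esParam β ^ ω.card * (1 - esParam β) ^ ωᶜ.card : ℝ) : ℂ) *
          (if (∀ σ ∈ ω, res (td₁ θ) σ = 0) then (ZMod.stdAddChar (pairing θ γ) : ℂ) else 0) := by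
      intro θ
      rw [esWeight_eq_ite]
      by_cases hθ : ∀ σ ∈ ω, res (td₁ θ) σ = 0
      · rw [if_pos hθ, if_pos hθ, wilsonLoopVar]
      · rw [if_neg hθ, if_neg hθ]
        simp
    simp_rw [h2]
    rw [← Finset.mul_sum, sum_char_pairing_eq]
    by_cases hV : IsNullHomologousIn ω γ
    · rw [if_pos ((forall_pairing_eq_zero_iff_isNullHomologousIn ω γ).mpr hV), if_pos hV]
      have hc : ((Finset.univ.filter fun θ : Site d L → Fin d → ZMod q =>
          ∀ σ ∈ ω, res (td₁ θ) σ = 0).card : ℂ) = (NB : ℂ) * (q : ℂ) ^ bettiOne (ZMod q) ω := by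
        have := card_filter_flat_eq q ω
        rw [hNB]
        exact_mod_cast this
      rw [hc, weight]
      push_cast
      ring
    · rw [if_neg (fun h => hV ((forall_pairing_eq_zero_iff_isNullHomologousIn ω γ).mp h)),
        if_neg hV]
      simp
  -- Step 2: denominator `E 𝒵 = NB Z_RC`
  have hden : E * pottsPartitionFn (d := d) (L := L) (ZMod q) β =
      NB * partitionFn (d := d) (L := L) (ZMod q) (esParam β) q := pottsPartitionFn_eq q β
  have hRCpos : 0 < partitionFn (d := d) (L := L) (ZMod q) (esParam β) q := by
    have h := mul_pos hEpos hZpos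
    rw [hden] at h
    exact (mul_pos_iff_of_pos_left hNBpos).mp h
  -- Step 3: assemble the two quotients
  set Sθ : ℂ := ∑ θ : Site d L → Fin d → ZMod q,
    (pottsWeight (ZMod q) β θ : ℂ) * wilsonLoopVar q γ θ with hSθ
  set Sω : ℂ := ∑ ω : Finset (Plaquette d L),
    (if IsNullHomologousIn ω γ then (weight (ZMod q) (esParam β) q ω : ℂ) else 0) with hSω
  have hZ0 : (pottsPartitionFn (d := d) (L := L) (ZMod q) β : ℂ) ≠ 0 := by exact_mod_cast hZpos.ne'
  have hRC0 : (partitionFn (d := d) (L := L) (ZMod q) (esParam β) q : ℂ) ≠ 0 := by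
    exact_mod_cast hRCpos.ne'
  have hL : pottsExpect (d := d) (L := L) (ZMod q) β (wilsonLoopVar q γ) =
      Sθ / (pottsPartitionFn (d := d) (L := L) (ZMod q) β : ℂ) := by
    unfold pottsExpect pottsProb
    rw [hSθ, Finset.sum_div]
    refine Finset.sum_congr rfl fun θ _ => ?_
    push_cast
    ring
  have hR : (eventProb (d := d) (L := L) (ZMod q) (esParam β) q {ω | IsNullHomologousIn ω γ} : ℂ) =
      Sω / (partitionFn (d := d) (L := L) (ZMod q) (esParam β) q : ℂ) := by
    unfold eventProb prob
    rw [Complex.ofReal_sum, hSω, Finset.sum_div]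
    refine Finset.sum_congr rfl fun ω _ => ?_
    simp only [Set.mem_setOf_eq]
    split_ifs <;> simp [Complex.ofReal_div]
  have hdenC : (E : ℂ) * (pottsPartitionFn (d := d) (L := L) (ZMod q) β : ℂ) =
      (NB : ℂ) * (partitionFn (d := d) (L := L) (ZMod q) (esParam β) q : ℂ) := by
    exact_mod_cast hden
  have hE0 : (E : ℂ) ≠ 0 := by exact_mod_cast hEpos.ne'
  have hNB0 : (NB : ℂ) ≠ 0 := by exact_mod_cast hNBpos.ne'
  rw [hL, hR, div_eq_div_iff hZ0 hRC0]
  -- from `E Sθ = NB Sω` and `E 𝒵 = NB Z_RC`: `E NB (Sθ Z_RC - Sω 𝒵) = 0`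
  have key : (E : ℂ) * (NB : ℂ) * (Sθ * (partitionFn (d := d) (L := L) (ZMod q) (esParam β) q : ℂ) -
      Sω * (pottsPartitionFn (d := d) (L := L) (ZMod q) β : ℂ)) = 0 := by
    linear_combination ((NB : ℂ) * (partitionFn (d := d) (L := L) (ZMod q) (esParam β) q : ℂ)) * hnum -
      ((NB : ℂ) * Sω) * hdenC
  have h0 := (mul_eq_zero.mp key).resolve_left (mul_ne_zero hE0 hNB0)
  exact sub_eq_zero.mp h0

end WilsonLoop

end PlaquetteRC

end Literature.MathematicalPhysics.QuantumFieldTheory
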